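import Literature.AlgebraicGeometry.HodgeTheory.HodgeClassLiftRationalHodgeMaps
import Literature.AlgebraicGeometry.HodgeTheory.GysinHodgeClassLiftProofs
import Literature.AlgebraicGeometry.HodgeTheory.AbsoluteHodgeClassesCupGysin
import Literature.AlgebraicGeometry.HodgeTheory.ComplexGysinSurjective
import Literature.AlgebraicGeometry.HodgeTheory.ComplexGysinHodgeType
import Literature.AlgebraicGeometry.HodgeTheory.ComplexOrientationCycleClassFacts
import Literature.AlgebraicGeometry.HodgeTheory.CurveCorrespondencePushforward
import Literature.AlgebraicGeometry.HodgeTheory.SurjectivePullbackAlgebraicClasses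
import Literature.AlgebraicGeometry.HodgeTheory.HodgeRiemannPolarizabilityProofs
import Literature.AlgebraicGeometry.HodgeTheory.HodgeConjecture
import Literature.NumberTheory.Transcendental.DeRhamTheoremMultiplicative
import Literature.Topology.FourManifolds.ComplexProjectiveSpaceCohomology
import Literature.AlgebraicGeometry.Motives.JacobianFiniteIndex
import HarnessLib

/-!
# The Hodge conjecture descends along surjective morphisms of any relative dimension (unit lifts through `f_*`)

Topic `Literature/AlgebraicGeometry/HodgeTheory`. PROVED over the tree, no named fact.

For `f : Z ↠ Y` a surjective morphism of smooth projective complex varieties, `dim Z = dim Y + r`: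
`HodgeConjectureFor dZ Z → HodgeConjectureFor dY Y` (`SurjectiveDescent.hodgeConjectureFor_of_surjective`). The
tree's `HodgeConjectureFor.of_surjective` (degree trick `f_* f^* = deg f · id`, van Geemen 1994 Lemma 3.7) is the
EQUIDIMENSIONAL case `dim Z = dim Y`; in print the general case is Arapura 2006 Cor. 1.2 ("`Y` is motivated by `X`
if there exists a surjective morphism `f : Xⁿ → Y`": cut `Z` down by hyperplane sections, then `(1/deg h) h^*`
splits `h_*`). Here, with one device and no cutting: a UNIT LIFT through `f_*`. Since `f_*` is onto
(`complexGysin_surjective_of_surjective`, Voisin I Lemma 7.28 transposed by Poincaré duality), `1_Y = f_* a`, and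
semisimplicity lets one choose `a ∈ H^{2r}(Z(ℂ); ℂ)` RATIONAL OF HODGE TYPE `(r, r)`
(`exists_hodgeClass_complexGysin_eq_one_of_surjective`, via the Hodge-class lift along rational Hodge-linear maps
with INTEGER Tate twists, `exists_isRationalClass_isOfHodgeType_eq_sum_int`, Voisin 2025 Cor. 2.12); then for a
rational `(p,p)`-class `c` on `Y`, `f^* c ∪ a` is rational of type `(p + r, p + r)`, hence algebraic on `Z`, and the
projection formula `f_*(f^* c ∪ a) = c ∪ f_* a = c` (`complexGysin_cup`, Fulton Young Tableaux App. B (6)) makes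
`c` algebraic (`complexGysin_mem_algebraicClasses_of_mem_algebraicClasses`).

* `SurjectiveDescent.map_baseChange_hodgeStructure_F_le_of_hodgeType_int`,
  `SurjectiveDescent.exists_isRationalClass_isOfHodgeType_eq_sum_int` — Voisin 2025 Cor. 2.12 for finite families of
  rational Hodge-linear maps with INTEGER Tate twists (the tree's `exists_isRationalClass_isOfHodgeType_eq_sum` has
  non-negative twists only);
* `SurjectiveDescent.dim_le_of_surjective` — `dim Y ≤ dim Z`, read off cohomology (`f^*` injective, Voisin I 7.28);
* `SurjectiveDescent.exists_hodgeClass_complexGysin_eq_one_of_surjective` — the Hodge unit lift;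
* `SurjectiveDescent.hodgeConjectureFor_of_surjective` — the descent.

Provenance: Literature home of §1/§3 (fact-free part) of
`Summits/HodgeConjecture/HodgeConjecture/Theorems/Ring2HypothesesDescentAbsoluteSurjections.lean` (seat ring2-b06
gen 77) and of the integer-twist engine of `Summits/HodgeConjecture/CorCM/Stage4StrictRoadDischarge.lean` §1 and
`Stage4StrictRoadSurjections.dim_le_of_surjective`, promoted so that Literature files (e.g. the blow-up / birational
invariance chain `SmoothBlowupHodgeConjecture`, cell `pub/hodge-nonav` row CL⁺) can cite them; the absolute-Hodge
variants (mod Deligne's facts) stay Summits-side.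

## References

* [Arapura2006] D. Arapura, Motivation for Hodge cycles, Adv. Math. 207 (2006), §1 Lemma 1.1, Cor. 1.2.
* [VoisinHodgeI2002] C. Voisin, Hodge Theory and Complex Algebraic Geometry I, §7.1.1, §7.3.2 Lemma 7.28,
  Remark 7.29, Lemma 7.30, Thm. 6.32.
* [Voisin2025] C. Voisin, §2.1, Prop. 2.11, Cor. 2.12 (Hodge-class lift along rational Hodge maps).
* [vanGeemen1994HodgeAV] B. van Geemen, An introduction to the Hodge conjecture for abelian varieties, §3.7 Lemma 3.7.
* [FultonYoungTableaux1997] W. Fulton, Young Tableaux, App. B §B.1 (5)–(6).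
* [VoisinHodgeII2003] C. Voisin, Hodge Theory and Complex Algebraic Geometry II, §9.2.4 Prop. 9.20–9.21.
-/

noncomputable section

open CategoryTheory AlgebraicGeometry MonoidalCategory CartesianMonoidalCategory
open scoped TensorProduct Manifold ContDiff
open Literature.AlgebraicTopology.SingularHomology
open Literature.AlgebraicGeometry Literature.AlgebraicGeometry.Motives Literature.AlgebraicGeometry.HodgeTheory

namespace Literature.AlgebraicGeometry.HodgeTheory

namespace SurjectiveDescent

/-! ## §1 Cor. 2.12 for rational Hodge-linear maps with INTEGER Tate twists -/

section Engine

variable {m n : ℕ} {Y X : SchemeOver ℂ}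

/-- **A rational map shifting Hodge types by an integer `s` — and killing the types it cannot shift — has
bidegree `(s, s)` for the Hodge filtrations** of the Hodge structures of Hodge symmetric models (Voisin 2025 §2.1
"Tate twist"; Voisin I §7.3.2): `G : Hᵃ(Y(ℂ); ℂ) → Hᵇ(X(ℂ); ℂ)`, `a + 2s = b`, sends type `(p, q)` to type
`(p + s, q + s)` when both are `≥ 0` (`hGtyp`), to `0` otherwise (`hGkill`), and `G (ι y) = ι (ψ y)`.  Proof as
the tree's `HodgeModel.map_baseChange_hodgeStructure_F_le` / `…_of_hodgeType`. [cite: Voisin2025, §2.1 (p. 23)]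
[cite: VoisinHodgeI2002, §7.1.1 Def. 7.4 and §7.3.2] -/
theorem map_baseChange_hodgeStructure_F_le_of_hodgeType_int
    (hI : hodgePQ_independent_of_hodgeModel) (hY : IsSmoothProjective m Y)
    (hX : IsSmoothProjective n X) (B : HodgeModel m Y) (A : HodgeModel n X)
    (hB : B.IsHodgeSymmetric) (hA : A.IsHodgeSymmetric) {a b : ℕ} (s : ℤ) (hab : (a : ℤ) + 2 * s = b)
    (G : complexBetti Y a →ₗ[ℂ] complexBetti X b)
    (hGtyp : ∀ ⦃p q : ℕ⦄ ⦃y : complexBetti Y a⦄, p + q = a → IsOfHodgeType m Y a p q y →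
      ∀ ⦃p' q' : ℕ⦄, (p' : ℤ) = p + s → (q' : ℤ) = q + s → IsOfHodgeType n X b p' q' (G y))
    (hGkill : ∀ ⦃p q : ℕ⦄ ⦃y : complexBetti Y a⦄, p + q = a → IsOfHodgeType m Y a p q y →
      ((p : ℤ) + s < 0 ∨ (q : ℤ) + s < 0) → G y = 0)
    (ψ : singularCohomology ℚ ℚ (ComplexPoints Y) a →ₗ[ℚ] singularCohomology ℚ ℚ (ComplexPoints X) b)
    (hψ : ∀ y, G (singularCohomology.ringChange (algebraMap ℚ ℂ) (ComplexPoints Y) a y) =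
      singularCohomology.ringChange (algebraMap ℚ ℂ) (ComplexPoints X) b (ψ y)) (r : ℤ) :
    ((B.hodgeStructure hY hB a).F r).map (ψ.baseChange ℂ) ≤
      (A.hodgeStructure hX hA b).F (r + s) := by
  rintro _ ⟨t, ht, rfl⟩
  rw [SetLike.mem_coe, HodgeModel.hodgeStructure_F, HodgeModel.ratF_eq_iSup] at ht
  rw [HodgeModel.hodgeStructure_F, HodgeModel.ratF_eq_iSup]
  induction ht using Submodule.iSup_induction' with
  | mem pq t ht =>
    by_cases hr : r ≤ (pq.1.1 : ℤ)
    · rw [iSup_pos hr, HodgeModel.mem_ratPiece_iff, HodgeModel.complexification_apply] at ht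
      have hpq : pq.1.1 + pq.1.2 = a := Finset.HasAntidiagonal.mem_antidiagonal.1 pq.2
      -- `G (β t) = β ((ψ ⊗ ℂ) t)`
      have key := apply_ofRatClassBaseChange_eq_smul G ψ 1
        (fun y ↦ by rw [one_smul]; exact hψ y) t
      rw [one_smul] at key
      have hty : IsOfHodgeType m Y a pq.1.1 pq.1.2 (ofRatClassBaseChange (ComplexPoints Y) a t) :=
        ⟨B, ht⟩
      by_cases hlt : (pq.1.1 : ℤ) + s < 0 ∨ (pq.1.2 : ℤ) + s < 0
      · -- the shifted type does not exist: `G (β t) = 0`, so `(ψ ⊗ ℂ) t = 0`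
        have h0 : G (ofRatClassBaseChange (ComplexPoints Y) a t) = 0 := hGkill hpq hty hlt
        rw [h0] at key
        have ht0 : ψ.baseChange ℂ t = 0 :=
          ofRatClassBaseChange_injective _ b (by rw [map_zero]; exact key.symm)
        rw [ht0]
        exact Submodule.zero_mem _
      · -- the shifted type `(p', q')`
        push Not at hlt
        obtain ⟨p', hp'⟩ : ∃ p' : ℕ, (p' : ℤ) = pq.1.1 + s := ⟨(pq.1.1 + s).toNat, Int.toNat_of_nonneg hlt.1⟩
        obtain ⟨q', hq'⟩ : ∃ q' : ℕ, (q' : ℤ) = pq.1.2 + s := ⟨(pq.1.2 + s).toNat, Int.toNat_of_nonneg hlt.2⟩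
        have htyp : IsOfHodgeType n X b p' q' (G (ofRatClassBaseChange (ComplexPoints Y) a t)) :=
          hGtyp hpq hty hp' hq'
        rw [key, hI.isOfHodgeType_iff hX A] at htyp
        have hsum : p' + q' = b := by omega
        have hanti : (p', q') ∈ Finset.HasAntidiagonal.antidiagonal b :=
          Finset.HasAntidiagonal.mem_antidiagonal.2 hsum
        refine Submodule.mem_iSup_of_mem ⟨(p', q'), hanti⟩ (Submodule.mem_iSup_of_mem ?_ ?_)
        · change r + s ≤ (p' : ℤ)
          omega
        · rw [HodgeModel.mem_ratPiece_iff, HodgeModel.complexification_apply]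
          exact htyp
    · rw [iSup_neg hr, Submodule.mem_bot] at ht
      rw [ht, map_zero]
      exact Submodule.zero_mem _
  | zero => rw [map_zero]; exact Submodule.zero_mem _
  | add x y _ _ hx hy => rw [map_add]; exact Submodule.add_mem _ hx hy

/-- **Hodge classes lift along a finite family of rational Hodge-linear maps with INTEGER Tate twists**
(Voisin 2025, Cor. 2.12 for `Σⱼ G j : ⊕ⱼ H^{2dⱼ}(Y j)(−sⱼ) → H^{2q}(X)`), UNCONDITIONALLY: `dⱼ + sⱼ = q`, `sⱼ ∈ ℤ`,
`G j` carrying rational classes to rational classes, type `(a, b)` to type `(a + sⱼ, b + sⱼ)` when both are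
`≥ 0` and to `0` otherwise; then a rational `(q, q)`-class in `Σⱼ im (G j)` is `Σⱼ G j (a j)` with `a j` rational
of type `(dⱼ, dⱼ)`.  The tree's `exists_isRationalClass_isOfHodgeType_eq_sum_of_hodgeStructures` (integer twists)
with real models (`exists_isReal_hodgeModel_holds`), `smoothProjective_hodgeStructure_isPolarizable_holds`,
`exists_ratLinearMap_of_isRationalClass` and §1. [cite: Voisin2025, Cor. 2.12, Prop. 2.11, §2.1 and proof of Prop. 3.8]
[cite: VoisinHodgeI2002, Thm. 6.32, §7.1.1, §7.1.2, Lemma 7.26 and §7.3.2] -/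
theorem exists_isRationalClass_isOfHodgeType_eq_sum_int
    (hX : IsSmoothProjective n X) {ι : Type} [Fintype ι] {m d : ι → ℕ}
    {Y : ι → SchemeOver ℂ} (hY : ∀ j, IsSmoothProjective (m j) (Y j)) (q : ℕ)
    (s : ι → ℤ) (hs : ∀ j, (d j : ℤ) + s j = q)
    (G : ∀ j, complexBetti (Y j) (2 * d j) →ₗ[ℂ] complexBetti X (2 * q))
    (hGrat : ∀ j y, IsRationalClass y → IsRationalClass (G j y))
    (hGtyp : ∀ j ⦃p q' : ℕ⦄ ⦃y : complexBetti (Y j) (2 * d j)⦄, p + q' = 2 * d j →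
      IsOfHodgeType (m j) (Y j) (2 * d j) p q' y →
        ∀ ⦃p₁ q₁ : ℕ⦄, (p₁ : ℤ) = p + s j → (q₁ : ℤ) = q' + s j →
          IsOfHodgeType n X (2 * q) p₁ q₁ (G j y))
    (hGkill : ∀ j ⦃p q' : ℕ⦄ ⦃y : complexBetti (Y j) (2 * d j)⦄, p + q' = 2 * d j →
      IsOfHodgeType (m j) (Y j) (2 * d j) p q' y → ((p : ℤ) + s j < 0 ∨ (q' : ℤ) + s j < 0) → G j y = 0)
    {c : complexBetti X (2 * q)} (hc : IsRationalClass c) (hc' : IsOfHodgeType n X (2 * q) q q c)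
    (hcg : c ∈ ⨆ j, LinearMap.range (G j)) :
    ∃ a : ∀ j, complexBetti (Y j) (2 * d j),
      (∀ j, IsRationalClass (a j) ∧ IsOfHodgeType (m j) (Y j) (2 * d j) (d j) (d j) (a j)) ∧
        c = ∑ j, G j (a j) := by
  have hI : hodgePQ_independent_of_hodgeModel := hodgePQ_independent_of_hodgeModel_holds
  -- real, hence Hodge symmetric, Hodge models
  obtain ⟨A, hA⟩ := exists_isReal_hodgeModel_holds n X hX
  have hB' : ∀ j, ∃ B : HodgeModel (m j) (Y j), B.IsReal :=
    fun j ↦ exists_isReal_hodgeModel_holds (m j) (Y j) (hY j)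
  choose B hB using hB'
  -- the maps are defined over `ℚ`
  have hψ' : ∀ j, ∃ ψ : singularCohomology ℚ ℚ (ComplexPoints (Y j)) (2 * d j) →ₗ[ℚ]
      singularCohomology ℚ ℚ (ComplexPoints X) (2 * q),
      ∀ y, G j (singularCohomology.ringChange (algebraMap ℚ ℂ) (ComplexPoints (Y j)) (2 * d j) y) =
        singularCohomology.ringChange (algebraMap ℚ ℂ) (ComplexPoints X) (2 * q) (ψ y) :=
    fun j ↦ exists_ratLinearMap_of_isRationalClass (G j) (hGrat j)
  choose ψ hψ using hψ'
  refine exists_isRationalClass_isOfHodgeType_eq_sum_of_hodgeStructures hY q G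
    (A.hodgeStructure hX hA.isHodgeSymmetric (2 * q))
    (fun j ↦ (B j).hodgeStructure (hY j) (hB j).isHodgeSymmetric (2 * d j))
    (fun j ↦ smoothProjective_hodgeStructure_isPolarizable_holds (hY j) (B j)
      (hB j).isHodgeSymmetric (2 * d j))
    (fun x hx ↦ (A.mem_hodgeClasses_iff_isOfHodgeType_ringChange hX hI hA.isHodgeSymmetric q x).2 hx)
    (fun j y hy ↦ ((B j).mem_hodgeClasses_iff_isOfHodgeType_ringChange (hY j) hI
      (hB j).isHodgeSymmetric (d j) y).1 hy)
    s (fun j ↦ by have := hs j; omega) ψ (fun j p ↦ ?_) hψ hc hc' hcg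
  exact map_baseChange_hodgeStructure_F_le_of_hodgeType_int hI (hY j) hX (B j) A
    (hB j).isHodgeSymmetric hA.isHodgeSymmetric (s j) (by have := hs j; push_cast; omega) (G j)
    (hGtyp j) (hGkill j) (ψ j) (hψ j) p

end Engine

/-! ## §2 Dimension along a surjection; the Hodge unit lift -/

section UnitLift

variable {dZ dY : ℕ} {Z Y : SchemeOver ℂ}

/-- **A surjective morphism of smooth projective complex varieties does not increase dimension** (`dim Y ≤ dim Z`
for `f : Z ↠ Y`), read off cohomology: `f^*` is one-to-one in every degree (Voisin I Lemma 7.28, the tree's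
`complexBetti_map_injective_of_surjective`), `H^{2 dim Y}(Y(ℂ); ℂ)` is a line (Poincaré duality `b_{2n} = b₀`,
`ComplexPoints.finrank_singularCohomology_eq_of_add_eq`, and `b₀ = 1`, `finrank_complexBetti_zero`), while
`H^{2 dim Y}(Z(ℂ); ℂ) = 0` if `dim Z < dim Y` (`subsingleton_complexBetti`).
[cite: VoisinHodgeI2002, §7.3.2 Lemma 7.28] [cite: HatcherAT2002, §3.3 Cor. 3.37] -/
theorem dim_le_of_surjective (hZ : IsSmoothProjective dZ Z) (hY : IsSmoothProjective dY Y) (f : Z ⟶ Y)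
    [Surjective f.left] : dY ≤ dZ := by
  by_contra h
  haveI := subsingleton_complexBetti hZ (show 2 * dZ < 2 * dY by omega)
  haveI : Subsingleton (complexBetti Y (2 * dY)) :=
    (complexBetti_map_injective_of_surjective hY hZ f (2 * dY)).subsingleton
  have h1 : Module.finrank ℂ (complexBetti Y (2 * dY)) = 1 := by
    change Module.finrank ℂ (singularCohomology ℂ ℂ (ComplexPoints Y) (2 * dY)) = 1
    rw [ComplexPoints.finrank_singularCohomology_eq_of_add_eq ℂ hY (p := 2 * dY) (q := 0) (by omega)]
    haveI := hY.pathConnectedSpace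
    exact Literature.Topology.FourManifolds.ComplexProjectiveSpace.finrank_singularCohomology_zero
  have h0 : Module.finrank ℂ (complexBetti Y (2 * dY)) = 0 := Module.finrank_zero_of_subsingleton
  omega

/-- **HODGE UNIT LIFT (fact-free).** For a surjective morphism `f : Z ↠ Y` of smooth projective complex varieties,
`dim Z = dim Y + r`, there is a RATIONAL class `a ∈ H^{2r}(Z(ℂ); ℂ)` OF HODGE TYPE `(r, r)` with `f_* a = 1_Y` (complex
orientations): `f_* : H^{2r}(Z)(r) → H⁰(Y)` is a surjective (`complexGysin_surjective_of_surjective`, Voisin I Lemma 7.28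
transposed by Poincaré duality) morphism of rational Hodge structures with Tate twist `−r`
(`isRationalClass_complexGysin_complexOrientationFamily`, `isOfHodgeType_complexGysin`, `complexGysin_eq_zero_of_hodgeType_of_lt`),
and Hodge classes lift along such maps (the Stage-4 engine `exists_isRationalClass_isOfHodgeType_eq_sum_int`, Voisin 2025
Cor. 2.12: polarisable rational Hodge structures are semisimple), applied to the Hodge class `1_Y`.
[cite: Voisin2025, Cor. 2.12 and Prop. 2.11] [cite: VoisinHodgeI2002, §7.3.2 Lemma 7.28, Remark 7.29 and Lemma 7.30] -/
theorem exists_hodgeClass_complexGysin_eq_one_of_surjective (hZ : IsSmoothProjective dZ Z) (hY : IsSmoothProjective dY Y)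
    (f : Z ⟶ Y) [Surjective f.left] {r : ℕ} (hr : dY + r = dZ) (hab : 2 * r + 2 * dY = 2 * 0 + 2 * dZ) :
    ∃ a : complexBetti Z (2 * r), IsRationalClass a ∧ IsOfHodgeType dZ Z (2 * r) r r a ∧
      complexGysin complexOrientationFamily hZ hY f hab a = singularCohomology.one ℂ (ComplexPoints Y) := by
  classical
  have hI : hodgePQ_independent_of_hodgeModel := hodgePQ_independent_of_hodgeModel_holds
  have h1 := isAbsoluteHodgeClass_one hY
  obtain ⟨a, ha, hsum⟩ := exists_isRationalClass_isOfHodgeType_eq_sum_int hY (ι := Unit) (m := fun _ ↦ dZ)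
    (d := fun _ ↦ r) (Y := fun _ ↦ Z) (fun _ ↦ hZ) 0 (fun _ ↦ -(r : ℤ)) (fun _ ↦ by push_cast; omega)
    (fun _ ↦ complexGysin complexOrientationFamily hZ hY f hab)
    (fun _ y hy ↦ isRationalClass_complexGysin_complexOrientationFamily hZ hY f hab hy)
    (fun _ p₀ q₀ y _ hy p₁ q₁ hp₁ hq₁ ↦ isOfHodgeType_complexGysin hI (fun _ _ ↦ nonempty_hodgeModel_holds)
      (fun E _ _ _ ↦ Literature.NumberTheory.Transcendental.exists_deRhamIsoFamily_holds E)
      complexOrientationFamily hZ hY f hab (by omega) (by omega) hy)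
    (fun _ p₀ q₀ y _ hy hlt ↦ by
      obtain ⟨B⟩ := nonempty_hodgeModel_holds (n := dZ) (X := Z) hZ
      obtain ⟨A⟩ := nonempty_hodgeModel_holds (n := dY) (X := Y) hY
      exact complexGysin_eq_zero_of_hodgeType_of_lt hI complexOrientationFamily hZ hY B A
        (cupPreservesHodgeType_of_multiplicative_deRham
          (fun E _ _ _ ↦ Literature.NumberTheory.Transcendental.exists_deRhamIsoFamily_holds E) hZ)
        (cupPreservesHodgeType_of_multiplicative_deRham
          (fun E _ _ _ ↦ Literature.NumberTheory.Transcendental.exists_deRhamIsoFamily_holds E) hY)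
        f hab (by omega) ((isOfHodgeType_iff_mem_hodgePQ hZ B _).1 hy))
    h1.isRationalClass h1.isOfHodgeType
    (Submodule.mem_iSup_of_mem ()
      (LinearMap.mem_range.2 (complexGysin_surjective_of_surjective complexOrientationFamily hZ hY f hab _)))
  refine ⟨a (), (ha ()).1, (ha ()).2, ?_⟩
  rw [hsum, Fintype.sum_unique]

/-- **THE HODGE CONJECTURE DESCENDS ALONG SURJECTIVE MORPHISMS OF ANY RELATIVE DIMENSION — HYPOTHESIS-FREE**: for
`f : Z ↠ Y` surjective between smooth projective complex varieties, `HodgeConjectureFor dZ Z → HodgeConjectureFor dY Y`.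
With the Hodge unit lift `a` of §1 (rational of type `(r,r)`, `f_* a = 1_Y`): a rational `(p,p)`-class `c` on `Y` pulls
back to a rational `(p,p)`-class, `f^* c ∪ a` is rational of type `(p+r, p+r)` (`IsRationalClass.cup`,
`cupPreservesHodgeType_of_multiplicative_deRham`), hence algebraic on `Z`, and `c = f_*(f^* c ∪ a)` is algebraic. The
tree's `HodgeConjectureFor.of_surjective` (degree trick, van Geemen Lemma 3.7) is the case `dim Z = dim Y`; Arapura's
Cor. 1.2 / the Stage-4 road reach arbitrary `f` only through HC on the POWERS of `Z`.
[cite: vanGeemen1994HodgeAV, §3.6–3.7 Lemma 3.7 (p. 236)] [cite: Arapura2006, §1 Cor. 1.2] [cite: Voisin2025, Cor. 2.12]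
[cite: VoisinHodgeII2003, §9.2.4 Prop. 9.20 and Prop. 9.21] [cite: FultonYoungTableaux1997, Appendix B §B.1 (6)] -/
theorem hodgeConjectureFor_of_surjective (hZ : IsSmoothProjective dZ Z) (hY : IsSmoothProjective dY Y) (f : Z ⟶ Y)
    [Surjective f.left] (h : HodgeConjectureFor dZ Z) : HodgeConjectureFor dY Y := by
  refine ⟨nonempty_hodgeModel_holds hY, fun p c hc hpp ↦ ?_⟩
  have hd : dY ≤ dZ := dim_le_of_surjective hZ hY f
  obtain ⟨r, hr⟩ : ∃ r, dY + r = dZ := ⟨dZ - dY, by omega⟩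
  obtain ⟨a, ha, haH, ha1⟩ := exists_hodgeClass_complexGysin_eq_one_of_surjective hZ hY f hr (by omega)
  have h2 : 2 * p + 2 * r = 2 * (p + r) := by omega
  have hrat : IsRationalClass (cupProduct h2 (complexBetti.map f (2 * p) c) a) := (hc.map _).cup h2 ha
  have htyp : IsOfHodgeType dZ Z (2 * (p + r)) (p + r) (p + r) (cupProduct h2 (complexBetti.map f (2 * p) c) a) :=
    cupPreservesHodgeType_of_multiplicative_deRham
      (fun E _ _ _ ↦ Literature.NumberTheory.Transcendental.exists_deRhamIsoFamily_holds E) hZ h2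
      (hpp.map_of_isSmoothProjective hZ hY f) haH
  have hpush := complexGysin_mem_algebraicClasses_of_mem_algebraicClasses complexOrientationFamily hZ hY f
    (show 2 * (p + r) + 2 * dY = 2 * p + 2 * dZ by omega) (h.2 (p + r) _ hrat htyp)
  rw [complexGysin_cup (OrientationFamily.hasPoincareDuality complexOrientationFamily) hZ hY f
      (p := 2 * p) (q := 2 * r) (a := 2 * (p + r)) (b := 2 * p) (q' := 2 * 0) (by omega) (by omega) (by omega) (by omega),
    ha1, cupProduct_one] at hpush
  exact hpush

end UnitLift

end SurjectiveDescent

end Literature.AlgebraicGeometry.HodgeTheory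

end
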